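import Summits.QuantumFields.YangMills.Theorems.FluctuationComparisonRegPrIntLPolymerMayerGasParam
import Summits.QuantumFields.YangMills.Theorems.FluctuationComparisonRegPrIntLBackgroundFormResponseCauchy
import Summits.QuantumFields.YangMills.Theorems.FluctuationComparisonRegPrIntLBackgroundFormAlgebra
import Literature.MathematicalPhysics.QuantumFieldTheory.Balaban1983to89.T3MinimiserStabilityReduction
import Literature.MathematicalPhysics.QuantumFieldTheory.Balaban1983to89.T3PrintedRegularMinimiser
import Literature.MathematicalPhysics.QuantumFieldTheory.Balaban1983to89.T3OrbitAverage
import Literature.MathematicalPhysics.QuantumFieldTheory.Balaban1983to89.B12ContinuousTransportInvariance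
import Literature.MathematicalPhysics.QuantumFieldTheory.Balaban1983to89.Node00.CanonicalTransportOfRecord
import Literature.MathematicalPhysics.QuantumFieldTheory.Balaban1983to89.TreeLengthTorusTwoPoint
import HarnessLib

/-!
# THE RESPONSE KNIT (v2 CELL FORM): SLICE LETTERS FOR THE BACKGROUND MAP ⇒ THE RESPONSE ROWS (r1)∕(r2) OF GASᵇᵍ∘ v2 (texts inline, def-free)

Cell `ym3-torus` (YM ladder rung R3 = continuum `SU(2)` Yang–Mills on the three-torus — a RUNG, NOT d = 4, NOT infinite volume, NOT a mass gap, NOT Clay).  Width seat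
`ym-ust-20520-w5` (gen 20); `--supports stmt-QuantumFields-20520 --as helper`, count-neutral, definition-free (row texts INLINE), default heartbeats.

WHAT.  The v2 cone of LINE g24-4 «background_form» (ideator `ym-r3-idea-1` g24; critic #496) in `Theorems/` reads, after today's width seats:
⟨GASᵇᵍ∘ v2⟩ →(LEAD w3-20520 g21's (GASᵛ²))→ ⟨BGFORMᵃ∘ v2⟩ →(this seat's `…CellAnalyticKnit`)→ ⟨BGFORM∘ v2⟩ →(w4-20520 g20's ✓`…CellKnit`)→ {S2β :412, GRAD∘}.
Every row in that chain carries the two RESPONSE clauses of the background map `M` VERBATIM: (r1) `‖M U e − M V e‖ ≤ σ_J·e^{−2μ d(b, blk e)}` for window pairs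
agreeing off `b`, and (r2) the MIXED two-bond clause with the PRODUCT kernel `σ₂,J·e^{−2μ d(b, blk e)}·e^{−2μ d(blk e, b′)}` — the card's WHY-FAIL (f) («the natural
Cauchy-estimate shape but not printed»).  ✓`…ResponseCauchy` (this seat) showed in the abstract that the product kernel is a COROLLARY, at half rate, of ONE-SIDED
first-order decay holding along COMPLEX one-bond moves + analyticity of the response ([Balaban1985Variational] Prop. 9 p.309 ∕ (182)–(190) pp.307–308 — both of the
shape print states).  THIS FILE makes that a ROW-LEVEL arrow on the LEAD's letter:
* **RESPᵃ∘** (hypothesis of §1) := GASᵇᵍ∘ v2's text (LEAD w3 g21's cut, HOME `ym-ust-20520-w3/g21/TEXT-GASbg-v2.w3g21.lean` 1669f1eacee7de38 = the `hG` binder of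
  (GASᵛ²)) with THREE changes, everything else VERBATIM: (1) one more uniform constant `1 < Rw` (the radius of the complex one-bond window move; print `≍ α₁∕θ_J`);
  (2) the mixed modulus `σ₂` and its two rows DROPPED (it is manufactured); (3) (r1)∧(r2) REPLACED by ONE clause of SLICE LETTERS: for every window square
  `U V W Z` (corners agreeing off `b` ∕ `b′` as in the rows) and every fine bond `e` a two-parameter family `g : ℂ → ℂ → ℂ⁸` through the four embedded registers
  (`g 0 0 = Z`, `g 1 0 = W`, `g 0 1 = V`, `g 1 1 = U` at `e`) whose `b′`-RESPONSE `z ↦ g z 1 − g z 0` is complex-differentiable on `ball 0 Rw` and bounded there by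
  `σ_J·e^{−4μ d(blk e, b′)}`, and whose `b`-RESPONSE `w ↦ g 1 w − g 0 w` is complex-differentiable on `ball 0 Rw` and bounded by `σ_J·e^{−4μ d(b, blk e)}` — reading:
  `g z w` = the complexified register `e` of print's minimiser when the window field is moved at `b` by `z` and at `b′` by `w` (Prop. 9: `U_k` analytic in the small
  field), the bounds = (190) on the complex domain, in the COARSE distance through `blk`.
* ★★★ `backgroundFormCellGas_of_response : ⟨RESPᵃ∘⟩ → ⟨GASᵇᵍ∘ v2 VERBATIM⟩` with `σ ↦ σ`, `σ₂ J := 2·σ J∕Rw` (super-polynomially small by ✓(H1) `superpoly_const_mul`):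
  (r2) IS ✓`…ResponseCauchy.resp2_of_sliceLetters_profile` at `P := PlaqSmall (θBal …)`, `D₁ b e := d b (blk e)`, `D₂ e b′ := d (blk e) b′`; (r1) from the DEGENERATE
  square `(b′, W, Z) := (b, U, V)` (the four agreements hold trivially; the `b`-response bound at `w = 0` + ✓`pi_norm_ofReal_eq` + `e^{−4μd} ≤ e^{−2μd}`); every
  other clause is passed through.
NET FOR THE CARD: an inhabitant of the v2 cone now owes, on the response side, the SLICE LETTERS only (first-order decay on the complex one-bond domain); (f) has left the
row.  (r1)'s volume-uniformity question (critic #496b, FL-15′) is UNTOUCHED: the slice letters re-express (r1), they do not discharge it.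

HONEST SCOPE.  Bookkeeping over ✓`…ResponseCauchy`; nothing of Bałaban's analyticity or decay is asserted or proved; RESPᵃ∘ ∕ GASᵇᵍ∘ v2 ∕ BGFORMᵃ∘ v2 ∕ BGFORM∘ v2 ∕ S2β ∕
GRAD∘ ∕ the five registered ∘-stubs (v11.4 0∕5, №36 intact) ∕ `FluctuationComparisonRegPrIntL` (20520) NOT proved; no summit is proved by a helper; rung R3 = SU(2) YM₃ on
T³ — NOT d = 4, NOT infinite volume, NOT a mass gap, NOT Clay.  Sorry-free, axioms standard.

References: [Balaban1985Variational] CMP 102 (1985) 277–309 (Sect. G p.305, Prop. 9 p.309, (182)–(190) pp.307–308); [Balaban1987RG1] CMP 109 ((0.22)–(0.25)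
pp.256–257, (1.11)–(1.14) p.262); [Balaban1988RG2Cluster] CMP 116 ((1.26) p.8, (2.41) p.21); [Balaban1989LargeFieldII] CMP 122 ((1.98)–(1.100) p.390).
-/

set_option autoImplicit false

noncomputable section

namespace Summit.QuantumFields.YangMills.Theorems.FluctuationComparisonRegPrIntLBackgroundFormCellResponseKnit

open MeasureTheory Filter Topology Set
open scoped BigOperators
open Literature.MathematicalPhysics.QuantumFieldTheory.Balaban1983to89
open Literature.MathematicalPhysics.QuantumFieldTheory.Balaban1983to89.T3ContinuumYM3Torus T3NestedUnitLaws T3UnitLawDensityEML T3UnitScaleTilt T3TiltDescent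
  T3PrintedRegularMinimiser T3LevelShift Missing T4Continuum
open Literature.MathematicalPhysics.QuantumFieldTheory.Balaban1983to89.TreeLengthTorus (TPt TDom IsTDom tsys TFaceConnected torusTreeLen)
open Literature.MathematicalPhysics.QuantumFieldTheory.Balaban1983to89.TreeLengthTorusGeometry (TTouch tgeometry)
open Literature.MathematicalPhysics.QuantumFieldTheory.Balaban1983to89.B12TreeDecay (kappa₀ K₀)
open Literature.MathematicalPhysics.QuantumFieldTheory.Balaban1983to89.B12Decay510Torus (pl1 tcubeOf)
open Literature.Probability.LatticeModels
open Summit.QuantumFields.YangMills.Theorems.FluctuationComparisonRegPrIntLPolymerMayerGas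
open Summit.QuantumFields.YangMills.Theorems.FluctuationComparisonRegPrIntLPolymerMayerGasParam
open Summit.QuantumFields.YangMills.Theorems.FluctuationComparisonRegPrIntLBackgroundFormResponseCauchy
open Summit.QuantumFields.YangMills.Theorems.FluctuationComparisonRegPrIntLBackgroundFormAlgebra (superpoly_const_mul)

/-! ## §1 RESPᵃ∘ → GASᵇᵍ∘ v2 -/

open Classical in
/-- ★★★ **RESPᵃ∘ → GASᵇᵍ∘ v2.**  Hypothesis = **RESPᵃ∘** (the LEAD's GASᵇᵍ∘ v2 text 1669f1eacee7de38 with `1 < Rw` added, `σ₂` dropped, and the response rows (r1)∧(r2)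
replaced by SLICE LETTERS for the background map along complex one-bond window moves — see the module docstring); conclusion = GASᵇᵍ∘ v2 VERBATIM (= the `hG` binder
of LEAD w3-20520 g21's (GASᵛ²) `backgroundFormCellAnalytic_of_gas`) with `σ ↦ σ`, `σ₂ J := 2·σ J∕Rw`: (r2) by ✓`resp2_of_sliceLetters_profile`, (r1) from the
degenerate square, the rest passed through. [cite: Balaban1985Variational, Prop. 9 p.309 and (182)-(190) pp.307-308; Balaban1987RG1, (0.22)-(0.25) pp.256-257; Balaban1988RG2Cluster, (2.41) p.21] -/
theorem backgroundFormCellGas_of_response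
    (hR :
        ∀ (L : ℕ), ∃ pS : ℝ, ∀ (b₀ p₀ : ℝ), 0 < b₀ → pS ≤ p₀ → 0 < p₀ → ∃ ε₁ : ℝ, 0 < ε₁ ∧ ∀ (ε₀ : ℝ), 0 < ε₀ → ε₀ ≤ ε₁ →
          ∃ γ₁ : ℝ, 0 < γ₁ ∧ ∃ (κ μ C As Ag R r₁ Rₐ Rw : ℝ) (Mc : ℕ) (_ : NeZero Mc), 0 < κ ∧ 0 ≤ μ ∧ 0 ≤ As ∧ 0 ≤ Ag ∧ 0 < Rₐ ∧ 1 < Rw ∧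
            2 * kappa₀ (4 * 2 ^ 3) (2 * 3) ≤ r₁ ∧ r₁ + 2 * kappa₀ (4 * 2 ^ 3) (2 * 3) + 2 ≤ R ∧
            Ag * Real.exp (5 * r₁ + 1) * K₀ (4 * 2 ^ 3) (2 * 3) * 7 * 32 ≤ 1 ∧ ∀ (F : T3Family) (γ : ℝ), F.L = L → 0 < γ → γ ≤ γ₁ →
            ∃ (σ : ℕ → ℝ), (∀ J, 0 ≤ σ J) ∧
              (∀ a : ℕ, Tendsto (fun J : ℕ => ((J : ℝ) + 1) ^ a * σ J) atTop (𝓝 0)) ∧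
              ∀ (ν : ℕ → (j : ℕ) → Measure (GaugeField (F.P j) 0 (Matrix.specialUnitaryGroup (Fin 2) ℂ))),
                (∀ K, ν K K = T4GenFunBounds.gibbsMeasure (F.P K) ((F.scheme ℰp γ).β K)) →
                (∀ K j, j < K → ν K j = Measure.map (descend F ℰp j) (ν K (j + 1))) →
                ∀ (J K : ℕ) (hJK : J ≤ K) (ρ : GaugeField (F.P J) 0 (Matrix.specialUnitaryGroup (Fin 2) ℂ) → ℝ),
                  (∀ U, PlaqSmall (θBal F.L γ b₀ p₀ J) U → 0 < ρ U) →
                  ν K J = (fieldMeasure _ _ _).withDensity (fun U => ENNReal.ofReal (ρ U)) →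
                  ContinuousOn ρ {U | PlaqSmall (θBal F.L γ b₀ p₀ J) U} →
                  ∃ (c₀ : ℝ) (d : PBond (F.P J) 0 → PBond (F.P J) 0 → ℝ) (blk : PBond (F.P K) 0 → PBond (F.P J) 0)
                    (M : GaugeField (F.P J) 0 (Matrix.specialUnitaryGroup (Fin 2) ℂ) → PBond (F.P K) 0 → (Fin 8 → ℝ))
                    (Ncb : ℕ) (_ : NeZero Ncb) (ecb : PBond (F.P J) 0 → TPt 3 (Ncb * Mc))
                    (D : PBond (F.P K) 0 → Set (Fin 8 → ℂ))
                    (𝒮 : Finset (TPt 3 Ncb) → (PBond (F.P K) 0 → (Fin 8 → ℂ)) → ℂ)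
                    (act : TDom 3 Ncb → (PBond (F.P K) 0 → (Fin 8 → ℂ)) → ℂ),
                    (∀ x y, 0 ≤ d x y) ∧ (∀ x y, d x y = d y x) ∧ (∀ x y z, d x z ≤ d x y + d y z) ∧
                    (∀ x, ∑ y, Real.exp (-(μ * d x y)) ≤ C) ∧
                    (∀ b b' : PBond (F.P J) 0, κ * (b.src.tdist b'.src : ℝ) ≤ μ * d b b') ∧
                    (∀ c c' : PBond (F.P J) 0, 2 * μ * d c c' ≤ (r₁ / 2 / ((Mc : ℝ) * 3)) * pl1 (ecb c - ecb c')) ∧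
                    (∀ e, IsOpen (D e)) ∧
                    (∀ (U : GaugeField (F.P J) 0 (Matrix.specialUnitaryGroup (Fin 2) ℂ)), PlaqSmall (θBal F.L γ b₀ p₀ J) U →
                        ∀ e, Metric.ball (fun (i : Fin 8) => (M U e i : ℂ)) (2 * Rₐ) ⊆ D e) ∧
                    (∀ (Y : Finset (TPt 3 Ncb)) (q q' : PBond (F.P K) 0 → (Fin 8 → ℂ)),
                        (∀ e, tcubeOf Ncb Mc (ecb (blk e)) ∈ Y → q e = q' e) → 𝒮 Y q = 𝒮 Y q') ∧
                    (∀ Y : Finset (TPt 3 Ncb), ¬ TFaceConnected Y → ∀ q, 𝒮 Y q = 0) ∧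
                    (∀ Y, DifferentiableOn ℂ (𝒮 Y) {q | ∀ e, q e ∈ D e}) ∧
                    (∀ Y, ∀ q ∈ {q : PBond (F.P K) 0 → (Fin 8 → ℂ) | ∀ e, q e ∈ D e}, ‖𝒮 Y q‖ ≤ As * Real.exp (-r₁ * torusTreeLen Y)) ∧
                    (∀ (Z : TDom 3 Ncb) (q q' : PBond (F.P K) 0 → (Fin 8 → ℂ)),
                        (∀ e, tcubeOf Ncb Mc (ecb (blk e)) ∈ Z.1 → q e = q' e) → act Z q = act Z q') ∧
                    (∀ Z, DifferentiableOn ℂ (act Z) {q | ∀ e, q e ∈ D e}) ∧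
                    (∀ Z, ∀ q ∈ {q : PBond (F.P K) 0 → (Fin 8 → ℂ) | ∀ e, q e ∈ D e}, ‖act Z q‖ ≤ Ag * Real.exp (-(R * torusTreeLen Z.1))) ∧
                    (∀ (U : GaugeField (F.P J) 0 (Matrix.specialUnitaryGroup (Fin 2) ℂ)), PlaqSmall (θBal F.L γ b₀ p₀ J) U →
                        ∀ Z, (act Z (fun e (i : Fin 8) => (M U e i : ℂ))).im = 0) ∧
                    (∀ (b b' : PBond (F.P J) 0) (U V W Z : GaugeField (F.P J) 0 (Matrix.specialUnitaryGroup (Fin 2) ℂ)),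
                        PlaqSmall (θBal F.L γ b₀ p₀ J) U → PlaqSmall (θBal F.L γ b₀ p₀ J) V →
                        PlaqSmall (θBal F.L γ b₀ p₀ J) W → PlaqSmall (θBal F.L γ b₀ p₀ J) Z →
                        (∀ e, e ≠ b → U e = V e) → (∀ e, e ≠ b' → U e = W e) → (∀ e, e ≠ b' → V e = Z e) → (∀ e, e ≠ b → W e = Z e) →
                        ∀ e : PBond (F.P K) 0, ∃ g : ℂ → ℂ → (Fin 8 → ℂ),
                          g 0 0 = (fun i => (M Z e i : ℂ)) ∧ g 1 0 = (fun i => (M W e i : ℂ)) ∧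
                          g 0 1 = (fun i => (M V e i : ℂ)) ∧ g 1 1 = (fun i => (M U e i : ℂ)) ∧
                          DifferentiableOn ℂ (fun z => g z 1 - g z 0) (Metric.ball 0 Rw) ∧
                          (∀ z ∈ Metric.ball (0 : ℂ) Rw, ‖g z 1 - g z 0‖ ≤ σ J * Real.exp (-(4 * μ * d (blk e) b'))) ∧
                          DifferentiableOn ℂ (fun w => g 1 w - g 0 w) (Metric.ball 0 Rw) ∧
                          (∀ w ∈ Metric.ball (0 : ℂ) Rw, ‖g 1 w - g 0 w‖ ≤ σ J * Real.exp (-(4 * μ * d b (blk e))))) ∧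
                    (∀ U : GaugeField (F.P J) 0 (Matrix.specialUnitaryGroup (Fin 2) ℂ), PlaqSmall (θBal F.L γ b₀ p₀ J) U →
                        Real.log (ρ U) + (F.scheme ℰp γ).β K * minActionRegPr F J K hJK ε₀ U =
                          c₀ + ∑ Y, (𝒮 Y (fun e (i : Fin 8) => (M U e i : ℂ))).re +
                            Real.log (polymerPartitionFunction TTouch (fun Z : TDom 3 Ncb => act Z (fun e (i : Fin 8) => (M U e i : ℂ))) Finset.univ).re)) :
      ∀ (L : ℕ), ∃ pS : ℝ, ∀ (b₀ p₀ : ℝ), 0 < b₀ → pS ≤ p₀ → 0 < p₀ → ∃ ε₁ : ℝ, 0 < ε₁ ∧ ∀ (ε₀ : ℝ), 0 < ε₀ → ε₀ ≤ ε₁ →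
        ∃ γ₁ : ℝ, 0 < γ₁ ∧ ∃ (κ μ C As Ag R r₁ Rₐ : ℝ) (Mc : ℕ) (_ : NeZero Mc), 0 < κ ∧ 0 ≤ μ ∧ 0 ≤ As ∧ 0 ≤ Ag ∧ 0 < Rₐ ∧
          2 * kappa₀ (4 * 2 ^ 3) (2 * 3) ≤ r₁ ∧ r₁ + 2 * kappa₀ (4 * 2 ^ 3) (2 * 3) + 2 ≤ R ∧
          Ag * Real.exp (5 * r₁ + 1) * K₀ (4 * 2 ^ 3) (2 * 3) * 7 * 32 ≤ 1 ∧ ∀ (F : T3Family) (γ : ℝ), F.L = L → 0 < γ → γ ≤ γ₁ →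
          ∃ (σ σ₂ : ℕ → ℝ), (∀ J, 0 ≤ σ J) ∧ (∀ J, 0 ≤ σ₂ J) ∧
            (∀ a : ℕ, Tendsto (fun J : ℕ => ((J : ℝ) + 1) ^ a * σ J) atTop (𝓝 0)) ∧
            (∀ a : ℕ, Tendsto (fun J : ℕ => ((J : ℝ) + 1) ^ a * σ₂ J) atTop (𝓝 0)) ∧
            ∀ (ν : ℕ → (j : ℕ) → Measure (GaugeField (F.P j) 0 (Matrix.specialUnitaryGroup (Fin 2) ℂ))),
              (∀ K, ν K K = T4GenFunBounds.gibbsMeasure (F.P K) ((F.scheme ℰp γ).β K)) →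
              (∀ K j, j < K → ν K j = Measure.map (descend F ℰp j) (ν K (j + 1))) →
              ∀ (J K : ℕ) (hJK : J ≤ K) (ρ : GaugeField (F.P J) 0 (Matrix.specialUnitaryGroup (Fin 2) ℂ) → ℝ),
                (∀ U, PlaqSmall (θBal F.L γ b₀ p₀ J) U → 0 < ρ U) →
                ν K J = (fieldMeasure _ _ _).withDensity (fun U => ENNReal.ofReal (ρ U)) →
                ContinuousOn ρ {U | PlaqSmall (θBal F.L γ b₀ p₀ J) U} →
                ∃ (c₀ : ℝ) (d : PBond (F.P J) 0 → PBond (F.P J) 0 → ℝ) (blk : PBond (F.P K) 0 → PBond (F.P J) 0)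
                  (M : GaugeField (F.P J) 0 (Matrix.specialUnitaryGroup (Fin 2) ℂ) → PBond (F.P K) 0 → (Fin 8 → ℝ))
                  (Ncb : ℕ) (_ : NeZero Ncb) (ecb : PBond (F.P J) 0 → TPt 3 (Ncb * Mc))
                  (D : PBond (F.P K) 0 → Set (Fin 8 → ℂ))
                  (𝒮 : Finset (TPt 3 Ncb) → (PBond (F.P K) 0 → (Fin 8 → ℂ)) → ℂ)
                  (act : TDom 3 Ncb → (PBond (F.P K) 0 → (Fin 8 → ℂ)) → ℂ),
                  (∀ x y, 0 ≤ d x y) ∧ (∀ x y, d x y = d y x) ∧ (∀ x y z, d x z ≤ d x y + d y z) ∧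
                  (∀ x, ∑ y, Real.exp (-(μ * d x y)) ≤ C) ∧
                  (∀ b b' : PBond (F.P J) 0, κ * (b.src.tdist b'.src : ℝ) ≤ μ * d b b') ∧
                  (∀ c c' : PBond (F.P J) 0, 2 * μ * d c c' ≤ (r₁ / 2 / ((Mc : ℝ) * 3)) * pl1 (ecb c - ecb c')) ∧
                  (∀ e, IsOpen (D e)) ∧
                  (∀ (U : GaugeField (F.P J) 0 (Matrix.specialUnitaryGroup (Fin 2) ℂ)), PlaqSmall (θBal F.L γ b₀ p₀ J) U →
                      ∀ e, Metric.ball (fun (i : Fin 8) => (M U e i : ℂ)) (2 * Rₐ) ⊆ D e) ∧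
                  (∀ (Y : Finset (TPt 3 Ncb)) (q q' : PBond (F.P K) 0 → (Fin 8 → ℂ)),
                      (∀ e, tcubeOf Ncb Mc (ecb (blk e)) ∈ Y → q e = q' e) → 𝒮 Y q = 𝒮 Y q') ∧
                  (∀ Y : Finset (TPt 3 Ncb), ¬ TFaceConnected Y → ∀ q, 𝒮 Y q = 0) ∧
                  (∀ Y, DifferentiableOn ℂ (𝒮 Y) {q | ∀ e, q e ∈ D e}) ∧
                  (∀ Y, ∀ q ∈ {q : PBond (F.P K) 0 → (Fin 8 → ℂ) | ∀ e, q e ∈ D e}, ‖𝒮 Y q‖ ≤ As * Real.exp (-r₁ * torusTreeLen Y)) ∧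
                  (∀ (Z : TDom 3 Ncb) (q q' : PBond (F.P K) 0 → (Fin 8 → ℂ)),
                      (∀ e, tcubeOf Ncb Mc (ecb (blk e)) ∈ Z.1 → q e = q' e) → act Z q = act Z q') ∧
                  (∀ Z, DifferentiableOn ℂ (act Z) {q | ∀ e, q e ∈ D e}) ∧
                  (∀ Z, ∀ q ∈ {q : PBond (F.P K) 0 → (Fin 8 → ℂ) | ∀ e, q e ∈ D e}, ‖act Z q‖ ≤ Ag * Real.exp (-(R * torusTreeLen Z.1))) ∧
                  (∀ (U : GaugeField (F.P J) 0 (Matrix.specialUnitaryGroup (Fin 2) ℂ)), PlaqSmall (θBal F.L γ b₀ p₀ J) U →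
                      ∀ Z, (act Z (fun e (i : Fin 8) => (M U e i : ℂ))).im = 0) ∧
                  (∀ (b : PBond (F.P J) 0) (U V : GaugeField (F.P J) 0 (Matrix.specialUnitaryGroup (Fin 2) ℂ)),
                      PlaqSmall (θBal F.L γ b₀ p₀ J) U → PlaqSmall (θBal F.L γ b₀ p₀ J) V → (∀ e, e ≠ b → U e = V e) →
                      ∀ e, ‖M U e - M V e‖ ≤ σ J * Real.exp (-(2 * μ * d b (blk e)))) ∧
                  (∀ (b b' : PBond (F.P J) 0) (U V W Z : GaugeField (F.P J) 0 (Matrix.specialUnitaryGroup (Fin 2) ℂ)),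
                      PlaqSmall (θBal F.L γ b₀ p₀ J) U → PlaqSmall (θBal F.L γ b₀ p₀ J) V →
                      PlaqSmall (θBal F.L γ b₀ p₀ J) W → PlaqSmall (θBal F.L γ b₀ p₀ J) Z →
                      (∀ e, e ≠ b → U e = V e) → (∀ e, e ≠ b' → U e = W e) → (∀ e, e ≠ b' → V e = Z e) → (∀ e, e ≠ b → W e = Z e) →
                      ∀ e, ‖M U e - M W e - M V e + M Z e‖ ≤
                        σ₂ J * (Real.exp (-(2 * μ * d b (blk e))) * Real.exp (-(2 * μ * d (blk e) b')))) ∧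
                  (∀ U : GaugeField (F.P J) 0 (Matrix.specialUnitaryGroup (Fin 2) ℂ), PlaqSmall (θBal F.L γ b₀ p₀ J) U →
                      Real.log (ρ U) + (F.scheme ℰp γ).β K * minActionRegPr F J K hJK ε₀ U =
                        c₀ + ∑ Y, (𝒮 Y (fun e (i : Fin 8) => (M U e i : ℂ))).re +
                          Real.log (polymerPartitionFunction TTouch (fun Z : TDom 3 Ncb => act Z (fun e (i : Fin 8) => (M U e i : ℂ))) Finset.univ).re) := by
  intro L
  obtain ⟨pS, HpS⟩ := hR L
  refine ⟨pS, ?_⟩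
  intro b₀ p₀ hb₀ hpS hp₀
  obtain ⟨ε₁, hε₁, Hε⟩ := HpS b₀ p₀ hb₀ hpS hp₀
  refine ⟨ε₁, hε₁, ?_⟩
  intro ε₀ hε₀ hε₀₁
  obtain ⟨γ₁, hγ₁, κ, μ, C, As, Ag, R, r₁, Rₐ, Rw, Mc, hMc, hκ, hμ, hAs, hAg, hRₐ, hRw, hr₁, hRr, hsmall, HF⟩ := Hε ε₀ hε₀ hε₀₁
  refine ⟨γ₁, hγ₁, κ, μ, C, As, Ag, R, r₁, Rₐ, Mc, hMc, hκ, hμ, hAs, hAg, hRₐ, hr₁, hRr, hsmall, ?_⟩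
  intro F γ hFL hγ hγ₁'
  obtain ⟨σ, hσ0, hσ, Hν⟩ := HF F γ hFL hγ hγ₁'
  have hRw0 : 0 < Rw := by linarith
  have hσ₂ : ∀ a : ℕ, Tendsto (fun J : ℕ => ((J : ℝ) + 1) ^ a * (2 * σ J / Rw)) atTop (𝓝 0) := fun a =>
    Tendsto.congr (fun J => by ring) (superpoly_const_mul (2 / Rw) hσ a)
  refine ⟨σ, fun J => 2 * σ J / Rw, hσ0, fun J => by have := hσ0 J; positivity, hσ, hσ₂, ?_⟩
  intro ν hνK hνd J K hJK ρ hρpos hρν hρcont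
  obtain ⟨c₀, d, blk, M, Ncb, hNcb, ecb, D, 𝒮, act, hd0, hdsym, hdtri, hdsum, hdcmp, hd6, hopen, hcol, hSloc, hSsupp, hShol, hSbd,
    hAloc, hAhol, hAbd, hAreal, hslice, hrep⟩ := Hν ν hνK hνd J K hJK ρ hρpos hρν hρcont
  refine ⟨c₀, d, blk, M, Ncb, hNcb, ecb, D, 𝒮, act, hd0, hdsym, hdtri, hdsum, hdcmp, hd6, hopen, hcol, hSloc, hSsupp, hShol, hSbd,
    hAloc, hAhol, hAbd, hAreal, ?_, ?_, hrep⟩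
  · -- (r1) from the degenerate square `(b', W, Z) := (b, U, V)` and the `b`-response letter at `w = 0`
    intro b U V hU hV hUV e
    obtain ⟨g, h00, h10, -, -, -, -, -, hχB⟩ :=
      hslice b b U V U V hU hV hU hV hUV (fun _ _ => rfl) (fun _ _ => rfl) hUV e
    have h0 : (0 : ℂ) ∈ Metric.ball (0 : ℂ) Rw := Metric.mem_ball_self hRw0
    have key := hχB 0 h0
    rw [h10, h00] at key
    have hemb : (fun i => (M U e i : ℂ)) - (fun i => (M V e i : ℂ)) = fun i => ((M U e - M V e) i : ℂ) := by
      funext i; simp [Complex.ofReal_sub]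
    rw [hemb, pi_norm_ofReal_eq] at key
    refine key.trans (mul_le_mul_of_nonneg_left ?_ (hσ0 J))
    rw [Real.exp_le_exp]
    nlinarith [hμ, hd0 b (blk e)]
  · -- (r2) from the slice letters by the profile edition of `resp2_of_sliceLetters`
    dsimp only
    exact resp2_of_sliceLetters_profile (fun U => PlaqSmall (θBal F.L γ b₀ p₀ J) U) (fun b e => d b (blk e)) (fun e b' => d (blk e) b') M
      hRw (hσ0 J) hμ hslice

end Summit.QuantumFields.YangMills.Theorems.FluctuationComparisonRegPrIntLBackgroundFormCellResponseKnit
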